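import Summits.AtomisticToContinuum.Crystallization.Theorems.ExcessDecayLiouvillePhononStabilityCertSlack

/-!
# Near-certificate layer V: class polynomial matrices and checked univariate models

Support file for crux `PhononStability` (line `contragredient-window-collapse`): polynomial matrices attached to a class, univariate rational polynomials with interval tail bounds (`nonnegDoubleRoot`, `nonnegOn`), products/bounds/composition of scalar polynomials, and the checked lower models of `ω`, `ψ` and of the far charge as functions of `ρ = r²`. [folklore]
-/

noncomputable section

open scoped BigOperators Classical InnerProductSpace
open Filter Set Function
open Summit.AtomisticToContinuum.Crystallization.Theorems.PhononStabilityNegative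

namespace Summit.AtomisticToContinuum.Crystallization.Theorems.PhononStabilityCWC.Cert

local notation "E3" => EuclideanSpace ℝ (Fin 3)

/-! ## Polynomial matrices attached to one class (the shape of every target term) -/

/-- the polynomial pair form of class `c` with matrix coefficients `L = [(α, K_α)]`: `Σ_α x^α · pair(c, K_α)` -/
def classPPF (c : BondClass) (L : List (Mono × Mat)) : PolyPF := L.map fun e => (e.1, pairTable c e.2)

/-- the real matrix `Σ_α x^α K_α` -/
def matVal (x : ℕ → ℝ) (L : List (Mono × Mat)) : Fin 3 → Fin 3 → ℝ :=
  fun i j => (L.map fun e => monoVal x e.1 * (e.2 i j : ℝ)).sum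

/-- the pair form of the empty polynomial matrix vanishes. [folklore] -/
theorem pairEvalR_matVal_nil (c : BondClass) (x : ℕ → ℝ) (w : Label → E3) :
    pairEvalR c (matVal x []) w = 0 := by
  simp [pairEvalR, matVal, bilR]

/-- **evaluation of a class polynomial pair form** = the pair form of the evaluated polynomial matrix -/
theorem evalPPF_classPPF {w : Label → E3} (hw : (support w).Finite) (c : BondClass) (L : List (Mono × Mat))
    (x : ℕ → ℝ) : evalPPF (classPPF c L) x w = pairEvalR c (matVal x L) w := by
  unfold classPPF
  induction L with
  | nil => simp [pairEvalR_matVal_nil]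
  | cons e rest ih =>
      rw [List.map_cons, evalPPF_cons, ih]
      have hsplit : matVal x (e :: rest) = fun i j => monoVal x e.1 * (e.2 i j : ℝ) + matVal x rest i j := by
        funext i j; simp [matVal]
      rw [hsplit, pairEvalR_add hw, pairEvalR_smul, ← pairEval_eq_pairEvalR, pairEval_eq_tpEval hw]

/-! ## Univariate rational polynomials (model validity is checked, not proved by calculus) -/

/-- univariate polynomial, coefficients `c₀, c₁, …` -/
abbrev UPoly := List ℚ

/-- Horner evaluation -/
def ueval (p : UPoly) (t : ℝ) : ℝ := p.foldr (fun c acc => (c : ℝ) + t * acc) 0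

/-- evaluation of the zero polynomial. [folklore] -/
@[simp] theorem ueval_nil (t : ℝ) : ueval [] t = 0 := rfl
/-- Horner step. [folklore] -/
@[simp] theorem ueval_cons (c : ℚ) (p : UPoly) (t : ℝ) : ueval (c :: p) t = c + t * ueval p t := rfl

/-- addition -/
def uadd : UPoly → UPoly → UPoly
  | [], q => q
  | p, [] => p
  | a :: p, b :: q => (a + b) :: uadd p q

/-- evaluation of a sum. [folklore] -/
theorem ueval_uadd (p q : UPoly) (t : ℝ) : ueval (uadd p q) t = ueval p t + ueval q t := by
  induction p generalizing q with
  | nil => simp [uadd]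
  | cons a p ih =>
      cases q with
      | nil => simp [uadd]
      | cons b q => simp only [uadd, ueval_cons, ih, Rat.cast_add]; ring

/-- scalar multiple -/
def usmul (a : ℚ) (p : UPoly) : UPoly := p.map (a * ·)

/-- evaluation of a scalar multiple. [folklore] -/
theorem ueval_usmul (a : ℚ) (p : UPoly) (t : ℝ) : ueval (usmul a p) t = a * ueval p t := by
  unfold usmul
  induction p with
  | nil => simp
  | cons c p ih => simp only [List.map_cons, ueval_cons, ih, Rat.cast_mul]; ring

/-- multiplication by `t` -/
def umulT (p : UPoly) : UPoly := 0 :: p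

/-- evaluation of `t·p`. [folklore] -/
theorem ueval_umulT (p : UPoly) (t : ℝ) : ueval (umulT p) t = t * ueval p t := by simp [umulT]

/-- multiplication -/
def umul : UPoly → UPoly → UPoly
  | [], _ => []
  | a :: p, q => uadd (usmul a q) (umulT (umul p q))

/-- evaluation of a product. [folklore] -/
theorem ueval_umul (p q : UPoly) (t : ℝ) : ueval (umul p q) t = ueval p t * ueval q t := by
  induction p with
  | nil => simp [umul]
  | cons a p ih => simp only [umul, ueval_uadd, ueval_usmul, ueval_umulT, ih, ueval_cons]; ring

/-- Taylor shift `p(a + t)` -/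
def ushift (a : ℚ) : UPoly → UPoly
  | [] => []
  | c :: p => uadd [c] (uadd (usmul a (ushift a p)) (umulT (ushift a p)))

/-- evaluation of a shifted polynomial. [folklore] -/
theorem ueval_ushift (a : ℚ) (p : UPoly) (t : ℝ) : ueval (ushift a p) t = ueval p (a + t) := by
  induction p with
  | nil => simp [ushift]
  | cons c p ih =>
      simp only [ushift, ueval_uadd, ueval_usmul, ueval_umulT, ih, ueval_cons, ueval_nil, mul_zero, add_zero]
      ring

/-- `Σ_k |c_k| h^(k+1)` (apply to the TAIL of a polynomial: the powers then start at 1) -/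
def utailBound (p : UPoly) (h : ℚ) : ℚ := ((p.zipIdx 0).map fun ci => |ci.1| * h ^ (ci.2 + 1)).sum

/-- cast of the tail bound. [folklore] -/
theorem utailBound_cast (p : UPoly) (h : ℚ) (n : ℕ) :
    ((((p.zipIdx n).map fun ci => |ci.1| * h ^ (ci.2 + 1)).sum : ℚ) : ℝ) =
      ((p.zipIdx n).map fun ci => |(ci.1 : ℝ)| * (h : ℝ) ^ (ci.2 + 1)).sum := by
  induction p generalizing n with
  | nil => simp
  | cons c p ih =>
      rw [List.zipIdx_cons, List.map_cons, List.sum_cons, List.map_cons, List.sum_cons, Rat.cast_add, ih (n + 1)]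
      push_cast
      ring

/-- a polynomial is bounded by its tail bound on `|t| ≤ h`. [folklore] -/
theorem abs_ueval_le (p : UPoly) {h : ℚ} {t : ℝ} (ht : |t| ≤ h) (n : ℕ) :
    |t ^ (n + 1) * ueval p t| ≤ ((p.zipIdx n).map fun ci => |(ci.1 : ℝ)| * (h : ℝ) ^ (ci.2 + 1)).sum := by
  induction p generalizing n with
  | nil => simp
  | cons c p ih =>
      rw [List.zipIdx_cons, List.map_cons, List.sum_cons, ueval_cons, mul_add]
      refine (abs_add_le _ _).trans (add_le_add ?_ ?_)
      · rw [abs_mul, abs_pow, mul_comm]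
        exact mul_le_mul_of_nonneg_left (pow_le_pow_left₀ (abs_nonneg t) ht (n + 1)) (abs_nonneg _)
      · rw [show t ^ (n + 1) * (t * ueval p t) = t ^ (n + 1 + 1) * ueval p t by ring]
        exact ih (n + 1)

/-- lower bound of a polynomial on `[-h, h]`: `c₀ − Σ_{k≥1} |c_k| h^k` -/
def ulowOn (p : UPoly) (h : ℚ) : ℚ := p.headD 0 - utailBound p.tail h

/-- the constant coefficient minus the tail bound is a lower bound on `|t| ≤ h`. [folklore] -/
theorem ulowOn_le (p : UPoly) (h : ℚ) {t : ℝ} (ht : |t| ≤ h) : (ulowOn p h : ℝ) ≤ ueval p t := by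
  unfold ulowOn utailBound
  cases p with
  | nil => simp
  | cons c q =>
      simp only [List.headD_cons, List.tail_cons, ueval_cons, Rat.cast_sub]
      rw [utailBound_cast]
      have := abs_ueval_le q ht 0
      rw [pow_one] at this
      have h2 := neg_abs_le (t * ueval q t)
      linarith

/-- **plain nonnegativity test on `[-h, h]`:** `c₀ ≥ Σ_{k≥1} |c_k| h^k`. -/
def nonnegOn1 (p : UPoly) (h : ℚ) : Bool := decide (0 ≤ ulowOn p h)

/-- centre of the `k`-th of 16 equal sub-intervals of `[−h, h]` -/
def subCentre (h : ℚ) (k : ℕ) : ℚ := -h + (2 * k + 1) * h / 16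

/-- the SUBDIVIDED crude test: the crude test on each of 16 equal sub-intervals (re-centred by `ushift`) -/
def nonnegOn (p : UPoly) (h : ℚ) : Bool :=
  decide (0 ≤ h) && (List.range 16).all fun k => nonnegOn1 (ushift (subCentre h k) p) (h / 16)

/-- nonnegativity on `|t| ≤ h` from the crude test. [folklore] -/
theorem ueval_nonneg_of_nonnegOn1 {p : UPoly} {h : ℚ} (hp : nonnegOn1 p h = true) {t : ℝ}
    (ht : |t| ≤ h) : 0 ≤ ueval p t := by
  unfold nonnegOn1 at hp
  simp only [decide_eq_true_eq] at hp
  have := ulowOn_le p h ht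
  have hp' : (0 : ℝ) ≤ ulowOn p h := by exact_mod_cast hp
  linarith

/-- every point of `[−h, h]` is within `h/16` of some sub-interval centre. [folklore] -/
theorem exists_subCentre {h : ℚ} (hh : 0 ≤ h) {t : ℝ} (ht : |t| ≤ h) :
    ∃ k < 16, |t - (subCentre h k : ℝ)| ≤ (h : ℝ) / 16 := by
  rcases eq_or_lt_of_le hh with h0 | hpos
  · refine ⟨0, by norm_num, ?_⟩
    subst h0
    simp only [subCentre]; push_cast
    rw [abs_le] at ht ⊢
    simp only [Rat.cast_zero, neg_zero] at ht ⊢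
    constructor <;> linarith [ht.1, ht.2]
  · have hR : (0 : ℝ) < h := by exact_mod_cast hpos
    set u : ℝ := (t + h) / (2 * h) with hu
    have hu0 : 0 ≤ u := by rw [hu]; apply div_nonneg <;> [linarith [(abs_le.mp ht).1]; linarith]
    have hu1 : u ≤ 1 := by rw [hu, div_le_one (by linarith)]; linarith [(abs_le.mp ht).2]
    set k : ℕ := min 15 ⌊16 * u⌋₊ with hk
    refine ⟨k, by omega, ?_⟩
    have hk1 : (k : ℝ) ≤ 16 * u := by
      have : (⌊16 * u⌋₊ : ℝ) ≤ 16 * u := Nat.floor_le (by linarith)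
      have : (k : ℝ) ≤ ⌊16 * u⌋₊ := by exact_mod_cast min_le_right 15 _
      linarith
    have hk2 : 16 * u ≤ k + 1 := by
      by_cases hc : ⌊16 * u⌋₊ ≤ 15
      · have : k = ⌊16 * u⌋₊ := by rw [hk]; exact min_eq_right hc
        rw [this]; exact (Nat.lt_floor_add_one (16 * u)).le
      · have : k = 15 := by rw [hk]; omega
        rw [this]; norm_num; linarith
    have ht' : t = -h + 2 * h * u := by rw [hu]; field_simp; ring
    simp only [subCentre]; push_cast
    rw [ht', abs_le]
    constructor <;> nlinarith [hk1, hk2, hR]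

/-- **nonnegativity on `|t| ≤ h` from the subdivided crude test.** [folklore] -/
theorem ueval_nonneg_of_nonnegOn {p : UPoly} {h : ℚ} (hp : nonnegOn p h = true) {t : ℝ}
    (ht : |t| ≤ h) : 0 ≤ ueval p t := by
  unfold nonnegOn at hp
  simp only [Bool.and_eq_true, decide_eq_true_eq, List.all_eq_true] at hp
  obtain ⟨hh, hall⟩ := hp
  obtain ⟨k, hk, hkt⟩ := exists_subCentre hh ht
  have h1 := hall k (List.mem_range.mpr hk)
  have h2 := ueval_nonneg_of_nonnegOn1 h1 (t := t - subCentre h k) (by push_cast; exact hkt)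
  rw [ueval_ushift] at h2
  simpa using h2

/-- **nonnegativity test with a double root at the centre:** `p = t² · q` (first two coefficients zero) and
`q₀ ≥ Σ_{k≥1} |q_k| h^k`. -/
def nonnegDoubleRoot (p : UPoly) (h : ℚ) : Bool :=
  match p with
  | c0 :: c1 :: q => decide (c0 = 0 ∧ c1 = 0) && nonnegOn q h
  | _ => decide (p.all (· = 0))

/-- nonnegativity on `|t| ≤ h` from the double-root test. [folklore] -/
theorem ueval_nonneg_of_doubleRoot {p : UPoly} {h : ℚ} (hp : nonnegDoubleRoot p h = true) {t : ℝ}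
    (ht : |t| ≤ h) : 0 ≤ ueval p t := by
  match p, hp with
  | [], _ => simp
  | [c0], hp =>
      simp only [nonnegDoubleRoot, List.all_cons, List.all_nil, Bool.and_true, decide_eq_true_eq] at hp
      simp [hp]
  | c0 :: c1 :: q, hp =>
      simp only [nonnegDoubleRoot, Bool.and_eq_true, decide_eq_true_eq] at hp
      obtain ⟨⟨h0, h1⟩, hq⟩ := hp
      subst h0; subst h1
      simp only [ueval_cons, Rat.cast_zero, zero_add]
      have := ueval_nonneg_of_nonnegOn hq ht
      nlinarith [sq_nonneg t]

/-! ## Box ranges of scalar polynomials -/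

/-- the absolute box bound of a scalar polynomial: `Σ_α |c_α| · B_α` -/
def spBound (hw : List (ℕ × ℚ)) (p : SPoly) : ℚ := (p.map fun e => |e.2| * monoBound hw e.1).sum

/-- all monomials of `p` are listed -/
def spListed (hw : List (ℕ × ℚ)) (p : SPoly) : Bool := p.all fun e => monoListed hw e.1

/-- cast of the box bound. [folklore] -/
theorem spBound_cast (hw : List (ℕ × ℚ)) (p : SPoly) :
    (spBound hw p : ℝ) = (p.map fun e => |(e.2 : ℝ)| * (monoBound hw e.1 : ℝ)).sum := by
  unfold spBound
  induction p with
  | nil => simp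
  | cons e rest ih =>
      rw [List.map_cons, List.sum_cons, List.map_cons, List.sum_cons, Rat.cast_add, ih]
      push_cast
      ring

/-- a scalar polynomial is bounded by its box bound. [folklore] -/
theorem abs_spEval_le (hw : List (ℕ × ℚ)) (x : ℕ → ℝ) (hx : ∀ q ∈ hw, |x q.1| ≤ (q.2 : ℝ)) (p : SPoly)
    (hp : spListed hw p = true) : |spEval p x| ≤ (spBound hw p : ℝ) := by
  unfold spListed at hp
  rw [List.all_eq_true] at hp
  rw [spBound_cast]
  induction p with
  | nil => simp
  | cons e rest ih =>
      rw [spEval_cons, List.map_cons, List.sum_cons]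
      refine (abs_add_le _ _).trans (add_le_add ?_ (ih fun f hf => hp f (List.mem_cons_of_mem _ hf)))
      rw [abs_mul, mul_comm]
      exact mul_le_mul_of_nonneg_left (abs_monoVal_le hw x hx e.1 (hp e (List.mem_cons_self ..))) (abs_nonneg _)

/-- a univariate polynomial composed with a scalar polynomial: `P(ℓ(x))` as a scalar polynomial -/
def ucompose (P : UPoly) (ℓ : SPoly) : SPoly :=
  P.foldr (fun c acc => spNorm (([], c) :: spMul ℓ acc)) []

/-- evaluation of a composition. [folklore] -/
theorem spEval_ucompose (P : UPoly) (ℓ : SPoly) (x : ℕ → ℝ) : spEval (ucompose P ℓ) x = ueval P (spEval ℓ x) := by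
  unfold ucompose
  induction P with
  | nil => simp [spEval]
  | cons c rest ih =>
      simp only [List.foldr_cons, spEval_spNorm, spEval_cons, ueval_cons, spEval_spMul, ih, monoVal, List.map_nil,
        List.prod_nil, one_mul]

/-! ## The Lennard-Jones coefficients as functions of the SQUARED length and their checked models -/

/-- `ω̃(ρ) = 14ρ⁻⁸ − 8ρ⁻⁵` (`omegaLJ r = ω̃(r²)`) -/
def omegaT (ρ : ℝ) : ℝ := 14 * ρ⁻¹ ^ 8 - 8 * ρ⁻¹ ^ 5
/-- `ψ̃(ρ) = −ρ⁻⁷ + ρ⁻⁴` (`psiLJ r = ψ̃(r²)`) -/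
def psiT (ρ : ℝ) : ℝ := -ρ⁻¹ ^ 7 + ρ⁻¹ ^ 4

/-- `ω(r)` as a function of `ρ = r²`. [folklore] -/
theorem omegaLJ_eq_omegaT (r : ℝ) : omegaLJ r = omegaT (r ^ 2) := by
  unfold omegaLJ omegaT
  rw [← inv_pow, ← pow_mul, ← pow_mul]

/-- `ψ(r)` as a function of `ρ = r²`. [folklore] -/
theorem psiLJ_eq_psiT (r : ℝ) : psiLJ r = psiT (r ^ 2) := by
  unfold psiLJ psiT
  rw [← inv_pow, ← pow_mul, ← pow_mul]

/-- the monomial `t ↦ (a + t)^n` as a univariate polynomial -/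
def upowShift (a : ℚ) (n : ℕ) : UPoly := ushift a ((List.replicate n (0 : ℚ)) ++ [1])

/-- evaluation of the monomial `tⁿ`. [folklore] -/
theorem ueval_replicate_zero_append_one (n : ℕ) (t : ℝ) : ueval (List.replicate n (0 : ℚ) ++ [1]) t = t ^ n := by
  induction n with
  | zero => simp
  | succ n ih => rw [List.replicate_succ, List.cons_append, ueval_cons, ih, Rat.cast_zero, zero_add, pow_succ, mul_comm]

/-- evaluation of `(a + t)ⁿ`. [folklore] -/
theorem ueval_upowShift (a : ℚ) (n : ℕ) (t : ℝ) : ueval (upowShift a n) t = ((a : ℝ) + t) ^ n := by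
  unfold upowShift
  rw [ueval_ushift, ueval_replicate_zero_append_one]

/-- numerator of `ω̃ − P`: `14 − 8(ρ̄+t)³ − (ρ̄+t)⁸ P(t)` -/
def omegaNum (ρbar : ℚ) (P : UPoly) : UPoly :=
  uadd [14] (uadd (usmul (-8) (upowShift ρbar 3)) (usmul (-1) (umul (upowShift ρbar 8) P)))

/-- numerator of `ψ̃ − Q`: `−1 + (ρ̄+t)³ − (ρ̄+t)⁷ Q(t)` -/
def psiNum (ρbar : ℚ) (Q : UPoly) : UPoly :=
  uadd [-1] (uadd (upowShift ρbar 3) (usmul (-1) (umul (upowShift ρbar 7) Q)))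

/-- numerator of `U + ω̃`: `U(ρ̄+t)⁸ + 14 − 8(ρ̄+t)³` (a far upper bound `U ≥ −ω̃ = |ω̃|`) -/
def farNum (ρbar U : ℚ) : UPoly :=
  uadd [14] (uadd (usmul (-8) (upowShift ρbar 3)) (usmul U (upowShift ρbar 8)))

/-- evaluation of the `ω` numerator. [folklore] -/
theorem ueval_omegaNum (ρbar : ℚ) (P : UPoly) (t : ℝ) :
    ueval (omegaNum ρbar P) t = 14 - 8 * ((ρbar : ℝ) + t) ^ 3 - ((ρbar : ℝ) + t) ^ 8 * ueval P t := by
  simp only [omegaNum, ueval_uadd, ueval_usmul, ueval_umul, ueval_upowShift, ueval_cons, ueval_nil]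
  push_cast; ring

/-- evaluation of the `ψ` numerator. [folklore] -/
theorem ueval_psiNum (ρbar : ℚ) (Q : UPoly) (t : ℝ) :
    ueval (psiNum ρbar Q) t = -1 + ((ρbar : ℝ) + t) ^ 3 - ((ρbar : ℝ) + t) ^ 7 * ueval Q t := by
  simp only [psiNum, ueval_uadd, ueval_usmul, ueval_umul, ueval_upowShift, ueval_cons, ueval_nil]
  push_cast; ring

/-- evaluation of the far numerator. [folklore] -/
theorem ueval_farNum (ρbar U : ℚ) (t : ℝ) :
    ueval (farNum ρbar U) t = 14 - 8 * ((ρbar : ℝ) + t) ^ 3 + (U : ℝ) * ((ρbar : ℝ) + t) ^ 8 := by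
  simp only [farNum, ueval_uadd, ueval_usmul, ueval_upowShift, ueval_cons, ueval_nil]
  push_cast; ring

/-- **checked lower model of `ω̃`:** on `|t| ≤ h` with `ρ̄ + t > 0`. -/
theorem model_le_omegaT {ρbar h : ℚ} {P : UPoly} (hchk : nonnegDoubleRoot (omegaNum ρbar P) h = true) {t : ℝ}
    (ht : |t| ≤ h) (hpos : 0 < (ρbar : ℝ) + t) : ueval P t ≤ omegaT ((ρbar : ℝ) + t) := by
  have hN := ueval_nonneg_of_doubleRoot hchk ht
  rw [ueval_omegaNum] at hN
  set ρ : ℝ := (ρbar : ℝ) + t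
  have hρ : ρ ≠ 0 := hpos.ne'
  have h8 : 0 < ρ ^ 8 := by positivity
  have h1 : ueval P t * ρ ^ 8 ≤ 14 - 8 * ρ ^ 3 := by linarith
  have h2 : ueval P t ≤ (14 - 8 * ρ ^ 3) / ρ ^ 8 := by
    rw [le_div_iff₀ h8]; exact h1
  have h3 : (14 - 8 * ρ ^ 3) / ρ ^ 8 = omegaT ρ := by
    unfold omegaT; field_simp
  linarith [h2, h3.le, h3.ge]

/-- **checked lower model of `ψ̃`.** -/
theorem model_le_psiT {ρbar h : ℚ} {Q : UPoly} (hchk : nonnegDoubleRoot (psiNum ρbar Q) h = true) {t : ℝ}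
    (ht : |t| ≤ h) (hpos : 0 < (ρbar : ℝ) + t) : ueval Q t ≤ psiT ((ρbar : ℝ) + t) := by
  have hN := ueval_nonneg_of_doubleRoot hchk ht
  rw [ueval_psiNum] at hN
  set ρ : ℝ := (ρbar : ℝ) + t
  have hρ : ρ ≠ 0 := hpos.ne'
  have h7 : 0 < ρ ^ 7 := by positivity
  have h1 : ueval Q t * ρ ^ 7 ≤ -1 + ρ ^ 3 := by linarith
  have h2 : ueval Q t ≤ (-1 + ρ ^ 3) / ρ ^ 7 := by
    rw [le_div_iff₀ h7]; exact h1
  have h3 : (-1 + ρ ^ 3) / ρ ^ 7 = psiT ρ := by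
    unfold psiT; field_simp
  linarith [h2, h3.le, h3.ge]

/-- **checked far upper bound:** `−ω̃(ρ̄ + t) ≤ U` on `|t| ≤ h`. -/
theorem neg_omegaT_le_far {ρbar h U : ℚ} (hchk : nonnegOn (farNum ρbar U) h = true) {t : ℝ}
    (ht : |t| ≤ h) (hpos : 0 < (ρbar : ℝ) + t) : -omegaT ((ρbar : ℝ) + t) ≤ U := by
  have hN := ueval_nonneg_of_nonnegOn hchk ht
  rw [ueval_farNum] at hN
  set ρ : ℝ := (ρbar : ℝ) + t
  have hρ : ρ ≠ 0 := hpos.ne'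
  have h8 : 0 < ρ ^ 8 := by positivity
  have h1 : -(14 - 8 * ρ ^ 3) ≤ (U : ℝ) * ρ ^ 8 := by linarith
  have h2 : -(14 - 8 * ρ ^ 3) / ρ ^ 8 ≤ U := by
    rw [div_le_iff₀ h8]; exact h1
  have h3 : -(14 - 8 * ρ ^ 3) / ρ ^ 8 = -omegaT ρ := by
    unfold omegaT; field_simp
  linarith [h2, h3.le, h3.ge]

/-- Anchor of this support file (registered stub of the line skeleton). -/
theorem stub_certModel : ∀ r : ℝ, omegaLJ r = omegaT (r ^ 2) ∧ psiLJ r = psiT (r ^ 2) :=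
  fun r => ⟨omegaLJ_eq_omegaT r, psiLJ_eq_psiT r⟩

end Summit.AtomisticToContinuum.Crystallization.Theorems.PhononStabilityCWC.Cert

end
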